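import Summits.CriticalPhenomena.PercolationContinuityZ3.Theorems.SahiMasterFamilyLocalToGlobalFourPrelim
import Summits.CriticalPhenomena.PercolationContinuityZ3.Theorems.SahiMasterFamilyStructSym
import Summits.CriticalPhenomena.PercolationContinuityZ3.Theorems.SahiMasterFamilyGluedFramesConsistent

/-!
# The local-to-global step at order four (THEOREM LG4), II: the two host configurations

Unit `prim-master-conj` (crux anchor stmt-CriticalPhenomena-4575), gen 11; memo HOME/prim-master-conj/TIGHTNESS-III.md §2.7.
Setting as in part I.  With two pure members `a, b` and two non-pure members `v, w` (`LG4Data`), a type-one point `χ₀` of `v` and a type-one point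
`ψ₀` of `w` either have the same (failed, host) pair — CASE A, `false_of_typeOne_parallel` — or crossed pairs — CASE B, `false_of_typeOne_crossed`;
both are impossible (vertex lemma; minimal annihilator point + walk + T1-robustness in a deletion face).  Hence `false_of_not_structured`:
`{a, b, v}` or `{a, b, w}` is structured.  Part III (`SahiMasterFamilyLocalToGlobalFour`) turns this into THEOREM LG4.
Pure combinatorics; axioms standard. [this work]
-/
noncomputable section

open scoped Classical

namespace Summit.CriticalPhenomena.PercolationContinuityZ3.Theorems

namespace GluedFrames

open Finset Function
open Literature.Probability.LatticeModels.Kahn2022 (Affects)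

variable {ι : Type*} [Fintype ι] {κ : Type*} (U : κ → Set (Set ι)) (W : Finset κ)

/-- The standing hypotheses of the order-four endgame, bundled. [this work] -/
structure LG4Data (a b v w : κ) : Prop where
  hU : ∀ k, IsUpperSet (U k)
  hne : ∀ k, (U k).Nonempty
  hns : ∀ k, U k ≠ Set.univ
  hWU : ∀ k, k ∈ W
  hS : ∀ h, Structured (faceT U h) W
  hd : ∀ x ∈ W, ∀ x' ∈ W, x ≠ x' → Disjoint (esupp (gframe U W x)) (esupp (gframe U W x'))
  hF : ∀ f, CoreFree U f → Structured (faceF U f) W ∧ FaceFConsistent U W f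
  hE0 : ∃ f, CoreFree U f
  hι : ∀ f : ι, ∃ h, h ≠ f
  hab : a ≠ b
  hav : a ≠ v
  haw : a ≠ w
  hbv : b ≠ v
  hbw : b ≠ w
  hvw : v ≠ w
  hrestv : ∀ u ∈ W, u ≠ v → u = a ∨ u = b ∨ u = w
  hrestw : ∀ u ∈ W, u ≠ w → u = a ∨ u = b ∨ u = v
  hpa : gann U W a = ∅
  hpb : gann U W b = ∅
  hNv : (gann U W v).Nonempty

variable {U W}

namespace LG4Data

variable {a b v w : κ} (D : LG4Data U W a b v w)
include D

/-- Symmetry `a ↔ b`. [this work] -/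
theorem swap_ab : LG4Data U W b a v w where
  hU := D.hU; hne := D.hne; hns := D.hns; hWU := D.hWU; hS := D.hS; hd := D.hd; hF := D.hF; hE0 := D.hE0; hι := D.hι
  hab := D.hab.symm; hav := D.hbv; haw := D.hbw; hbv := D.hav; hbw := D.haw; hvw := D.hvw
  hrestv := fun u hu h => by rcases D.hrestv u hu h with h | h | h <;> simp [h]
  hrestw := fun u hu h => by rcases D.hrestw u hu h with h | h | h <;> simp [h]
  hpa := D.hpb; hpb := D.hpa; hNv := D.hNv

/-- Symmetry `v ↔ w` (needs `w` non-pure). [this work] -/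
theorem swap_vw (hNw : (gann U W w).Nonempty) : LG4Data U W a b w v where
  hU := D.hU; hne := D.hne; hns := D.hns; hWU := D.hWU; hS := D.hS; hd := D.hd; hF := D.hF; hE0 := D.hE0; hι := D.hι
  hab := D.hab; hav := D.haw; haw := D.hav; hbv := D.hbw; hbw := D.hbv; hvw := D.hvw.symm
  hrestv := D.hrestw; hrestw := D.hrestv; hpa := D.hpa; hpb := D.hpb; hNv := hNw

/-- (auxiliary) `ga`. [this work] -/
theorem ga : gframe U W a = U a := (gann_eq_empty_iff U W D.hU a).1 D.hpa
/-- (auxiliary) `gb`. [this work] -/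
theorem gb : gframe U W b = U b := (gann_eq_empty_iff U W D.hU b).1 D.hpb
/-- (auxiliary) `ha`. [this work] -/
theorem ha : a ∈ W := D.hWU a
/-- (auxiliary) `hb`. [this work] -/
theorem hb : b ∈ W := D.hWU b
/-- (auxiliary) `hv`. [this work] -/
theorem hv : v ∈ W := D.hWU v
/-- (auxiliary) `hw`. [this work] -/
theorem hw : w ∈ W := D.hWU w

/-- A core-free coordinate in the support of a pure member is a vertex of it. [this work] -/
theorem mem_verts_of_coreFree_pure {x : κ} (hx : gframe U W x = U x) {f : ι} (hf : CoreFree U f) (hfx : f ∈ esupp (U x)) :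
    f ∈ verts (U x) := by
  have := mem_verts_gframe_of_coreFree U W D.hU hf (w := x) (by rw [hx]; exact hfx)
  rwa [hx] at this

/-- Vertices of a glued frame are core-free. [this work] -/
theorem coreFree_of_verts {x : κ} {f : ι} (hf : f ∈ verts (gframe U W x)) : CoreFree U f :=
  coreFree_of_mem_verts U W D.hU D.hne D.hS D.hd D.hWU D.hι (D.hWU x) hf

/-! ### CASE A: parallel type-one points (same failed pure `a`, same host `b`) -/

/-- In case A no vertex of `U a` exists (`a` = the common failed pure member). [this work] -/
theorem verts_failed_eq_empty {χ₀ ψ₀ : Set ι} (hχ : TypeOne U W v w a b χ₀) (hψ : TypeOne U W w v a b ψ₀) : verts (U a) = ∅ := by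
  refine eq_empty_of_forall_notMem fun f hf => ?_
  have hfa : f ∈ esupp (U a) := (mem_verts.1 hf).1
  have hfcf : CoreFree U f := D.coreFree_of_verts (x := a) (by rw [D.ga]; exact hf)
  have A := typeOne_antipodal U W D.hU D.hne D.hS D.hF D.hv D.hw D.hrestv D.hrestw D.hpa D.hpb
    (Or.inl ⟨rfl, rfl⟩) (Or.inl ⟨rfl, rfl⟩) hχ hψ
  rcases A.2 f hfcf with h | h
  · rcases mem_esupp_or_of_typeOne U W D.hU D.hne D.hS D.hF D.hv D.hw D.hrestv D.hrestw D.hpa D.hpb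
      (Or.inl ⟨rfl, rfl⟩) (Or.inl ⟨rfl, rfl⟩) hχ hψ hfcf h with h1 | h1
    · exact Finset.disjoint_left.1 (D.hd a D.ha v D.hv D.hav) (by rw [D.ga]; exact hfa) h1
    · exact Finset.disjoint_left.1 (D.hd a D.ha b D.hb D.hab) (by rw [D.ga]; exact hfa) (by rw [D.gb]; exact h1)
  · rcases mem_esupp_or_of_typeOne U W D.hU D.hne D.hS D.hF D.hw D.hv D.hrestw D.hrestv D.hpa D.hpb
      (Or.inl ⟨rfl, rfl⟩) (Or.inl ⟨rfl, rfl⟩) hψ hχ hfcf h with h1 | h1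
    · exact Finset.disjoint_left.1 (D.hd a D.ha w D.hw D.haw) (by rw [D.ga]; exact hfa) h1
    · exact Finset.disjoint_left.1 (D.hd a D.ha b D.hb D.hab) (by rw [D.ga]; exact hfa) (by rw [D.gb]; exact h1)

/-- **CASE A, core**: parallel type-one points with a vertex `f₀` of the host `U b` lying in `χ₀` are impossible
(minimal point `μ` of `gann v`, `π = μ ∪ esupp (U a)`, walk, T1 in the deletion face at `f₀`). [this work] -/
theorem false_of_parallel_core {χ₀ ψ₀ : Set ι} (hχ : TypeOne U W v w a b χ₀) (hψ : TypeOne U W w v a b ψ₀) {f₀ : ι}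
    (hf₀ : f₀ ∈ verts (U b)) (hf₀χ : f₀ ∈ χ₀) : False := by
  have hU := D.hU
  have hVa := D.verts_failed_eq_empty hχ hψ
  have hf₀b : f₀ ∈ esupp (U b) := (mem_verts.1 hf₀).1
  have hf₀cf : CoreFree U f₀ := D.coreFree_of_verts (x := b) (by rw [D.gb]; exact hf₀)
  have A := typeOne_antipodal U W hU D.hne D.hS D.hF D.hv D.hw D.hrestv D.hrestw D.hpa D.hpb
    (Or.inl ⟨rfl, rfl⟩) (Or.inl ⟨rfl, rfl⟩) hχ hψ
  have hf₀ψ : f₀ ∉ ψ₀ := fun h => A.1 f₀ ⟨hf₀χ, h⟩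
  -- minimal point of `gann v` and the configuration `π`
  obtain ⟨μ, hμN, -, hμS⟩ := exists_minimal_gann U hU W D.hNv
  set π : Set ι := μ ∪ ↑(esupp (U a)) with hπdef
  have hπg : π ∈ gframe U W v := isUpperSet_gframe U W hU v Set.subset_union_left hμN.1
  have hπa : π ∈ U a := (mem_iff_esupp_subset_of_verts_eq_empty (hU a) (D.hne a) hVa π).2 Set.subset_union_right
  have hdis_b : Disjoint π ↑(esupp (U b)) := by
    rw [hπdef, Set.disjoint_union_left]
    refine ⟨Set.disjoint_of_subset_left hμS (disjoint_coe.2 ?_), disjoint_coe.2 ?_⟩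
    · have := D.hd v D.hv b D.hb D.hbv.symm; rwa [D.gb] at this
    · have := D.hd a D.ha b D.hb D.hab; rwa [D.ga, D.gb] at this
  have hπb : π ∉ U b := not_mem_of_disjoint_esupp (hU b) (D.hns b) hdis_b
  have hgw_ne : gframe U W w ≠ Set.univ := fun h => hχ.2.1 (h ▸ Set.mem_univ _)
  have hdis_w : Disjoint π ↑(esupp (gframe U W w)) := by
    rw [hπdef, Set.disjoint_union_left]
    refine ⟨Set.disjoint_of_subset_left hμS (disjoint_coe.2 (D.hd v D.hv w D.hw D.hvw)), disjoint_coe.2 ?_⟩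
    have := D.hd a D.ha w D.hw D.haw; rwa [D.ga] at this
  have hπw : π ∉ gframe U W w := not_mem_of_disjoint_esupp (isUpperSet_gframe U W hU w) hgw_ne hdis_w
  -- `π` must lie in `U v`: otherwise it is a type-one point (failed `b`, host `a`) with the wrong trace
  have hπv : π ∈ U v := by
    by_contra hπv
    have hπT : TypeOne U W v w b a π := ⟨⟨hπg, hπv⟩, hπw, hπb, hπa⟩
    have := (typeOne_trace_eq U W hU D.hne D.hS D.hF D.hv D.hw D.hrestv D.hrestw D.hpa D.hpb
      (Or.inl ⟨rfl, rfl⟩) (Or.inr ⟨rfl, rfl⟩) (Or.inl ⟨rfl, rfl⟩) hχ hπT hψ hf₀cf).1 hf₀χ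
    exact Set.disjoint_left.1 hdis_b this (mem_coe.2 hf₀b)
  -- walk from `μ ∉ U v` to `π ∈ U v` through `esupp (U a)`
  obtain ⟨T, hT, g, hg, hω, hω'⟩ := exists_step_of_union_mem (A := U v) hμN.2 (esupp (U a)) hπv
  set ω : Set ι := μ ∪ ↑T with hωdef
  have hf₀a : f₀ ∉ esupp (U a) := fun h =>
    Finset.disjoint_left.1 (D.hd a D.ha b D.hb D.hab) (by rw [D.ga]; exact h) (by rw [D.gb]; exact hf₀b)
  have hf₀ω' : f₀ ∉ insert g ω := by
    rintro (rfl | h)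
    · exact hf₀a hg
    · rcases h with h | h
      · exact Finset.disjoint_left.1 (D.hd v D.hv b D.hb D.hbv.symm) (mem_coe.1 (hμS h)) (by rw [D.gb]; exact hf₀b)
      · exact hf₀a (hT (mem_coe.1 h))
  have hf₀ω : f₀ ∉ ω := fun h => hf₀ω' (Set.mem_insert_of_mem g h)
  -- `g` is essential for both `(U v)^{f₀←0}` and `(U a)^{f₀←0}`
  have hgv : g ∈ esupp (faceF U f₀ v) := by
    rw [mem_esupp]
    refine ⟨ω, ?_, ?_⟩
    · rw [faceF_apply, mem_secAt_false_iff_of_notMem hf₀ω]; exact hω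
    · rw [faceF_apply, mem_secAt_false_iff_of_notMem hf₀ω']; exact hω'
  have hga' : g ∈ esupp (faceF U f₀ a) := by
    rw [faceF_apply, secAt_eq_self_of_not_affects (hU a) (fun h => hf₀a (mem_esupp.2 h)) false]; exact hg
  -- T1 in the deletion face at `f₀` (on `ψ₀`'s side): `{a, v}` must be structured there
  obtain ⟨hFs, hFc⟩ := D.hF f₀ hf₀cf
  set Φ := faceF U f₀ with hΦdef
  have hΦU : ∀ k, IsUpperSet (Φ k) := isUpperSet_faceF U hU f₀
  have hΦne : ∀ k, (Φ k).Nonempty := faceF_nonempty U hf₀cf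
  have hψA : ψ₀ ∈ cframe Φ W w := by rw [hFc w D.hw, mem_secAt_false_iff_of_notMem hf₀ψ]; exact hψ.1.1
  have hψU : ψ₀ ∉ Φ w := by rw [hΦdef, faceF_apply, mem_secAt_false_iff_of_notMem hf₀ψ]; exact hψ.1.2
  have hN : ¬ (cframe Φ W w ⊆ Φ w) := fun h => hψU (h hψA)
  have hWw : Structured Φ (W.erase w) := structured_erase_of_not_subset Φ hΦU hΦne hFs D.hw hN
  have hsafe : ψ₀ ∈ Safe Φ (W.erase w) := annihilator_subset_safe_erase Φ hΦU hΦne hFs D.hw hWw ⟨hψA, hψU⟩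
  have hrob := ((mem_safe_iff_cfail Φ hΦU hΦne hWw ψ₀).1 hsafe).2
  have hsub : cfail Φ (W.erase w) ψ₀ ⊆ ({a, v} : Finset κ) := by
    intro j hj
    rw [mem_cfail] at hj
    rw [cframe_erase Φ hΦU hΦne hFs hWw hj.1, hFc j (mem_of_mem_erase hj.1), mem_secAt_false_iff_of_notMem hf₀ψ] at hj
    have hjw : j ≠ w := ne_of_mem_erase hj.1
    rcases D.hrestw j (mem_of_mem_erase hj.1) hjw with rfl | rfl | rfl
    · simp
    · rw [D.gb] at hj; exact absurd hψ.2.2.2 hj.2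
    · simp
  have hR : ({a, v} : Finset κ) ⊆ W.erase w := by
    intro j hj
    simp only [mem_insert, mem_singleton] at hj
    rcases hj with rfl | rfl
    · exact mem_erase.2 ⟨D.haw, D.ha⟩
    · exact mem_erase.2 ⟨D.hvw, D.hv⟩
  have hpair : Structured Φ ({a, v} : Finset κ) := hrob _ hsub hR
  exact Finset.disjoint_left.1 (disjoint_esupp_of_structured_pair Φ hΦU D.hav hpair) hga' hgv

/-- **CASE A**: parallel type-one points are impossible. [this work] -/
theorem false_of_typeOne_parallel (hNw : (gann U W w).Nonempty) {χ₀ ψ₀ : Set ι} (hχ : TypeOne U W v w a b χ₀)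
    (hψ : TypeOne U W w v a b ψ₀) : False := by
  have hU := D.hU
  by_cases hVb : verts (U b) = ∅
  · -- `U b` is principal on its support, which lies in both `χ₀` and `ψ₀`: empty support, `U b = univ`
    have h1 : ↑(esupp (U b)) ⊆ χ₀ := (mem_iff_esupp_subset_of_verts_eq_empty (hU b) (D.hne b) hVb χ₀).1 hχ.2.2.2
    have h2 : ↑(esupp (U b)) ⊆ ψ₀ := (mem_iff_esupp_subset_of_verts_eq_empty (hU b) (D.hne b) hVb ψ₀).1 hψ.2.2.2
    have A := typeOne_antipodal U W hU D.hne D.hS D.hF D.hv D.hw D.hrestv D.hrestw D.hpa D.hpb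
      (Or.inl ⟨rfl, rfl⟩) (Or.inl ⟨rfl, rfl⟩) hχ hψ
    have hempty : esupp (U b) = ∅ := eq_empty_of_forall_notMem fun f hf => A.1 f ⟨h1 (mem_coe.2 hf), h2 (mem_coe.2 hf)⟩
    rcases eq_empty_or_univ_of_esupp_eq_empty (hU b) hempty with h | h
    · exact absurd h (D.hne b).ne_empty
    · exact D.hns b h
  · obtain ⟨f₀, hf₀⟩ := nonempty_iff_ne_empty.2 hVb
    have hf₀cf : CoreFree U f₀ := D.coreFree_of_verts (x := b) (by rw [D.gb]; exact hf₀)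
    have A := typeOne_antipodal U W hU D.hne D.hS D.hF D.hv D.hw D.hrestv D.hrestw D.hpa D.hpb
      (Or.inl ⟨rfl, rfl⟩) (Or.inl ⟨rfl, rfl⟩) hχ hψ
    rcases A.2 f₀ hf₀cf with h | h
    · exact D.false_of_parallel_core hχ hψ hf₀ h
    · exact (D.swap_vw hNw).false_of_parallel_core hψ hχ hf₀ h

/-! ### CASE B: crossed type-one points (`χ₀` fails `a`, hosted by `b`; `ψ₀` fails `b`, hosted by `a`) -/

/-- In case B the host `U b` of `χ₀` has no vertex. [this work] -/
theorem verts_host_eq_empty {χ₀ ψ₀ : Set ι} (hχ : TypeOne U W v w a b χ₀) (hψ : TypeOne U W w v b a ψ₀) : verts (U b) = ∅ := by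
  have hU := D.hU
  refine verts_eq_empty_of_pivotal (hU b) hχ.2.2.2 (fun f hf => ?_) (fun f hf => ?_)
  all_goals
    have hf' := mem_coe.1 hf
    have hfb : f ∈ esupp (U b) := (mem_verts.1 hf').1
    have hfcf : CoreFree U f := D.coreFree_of_verts (x := b) (by rw [D.gb]; exact hf')
    have A := typeOne_antipodal U W hU D.hne D.hS D.hF D.hv D.hw D.hrestv D.hrestw D.hpa D.hpb
      (Or.inl ⟨rfl, rfl⟩) (Or.inr ⟨rfl, rfl⟩) hχ hψ
    have hfχ : f ∈ χ₀ := by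
      rcases A.2 f hfcf with h | h
      · exact h
      · exfalso
        rcases mem_esupp_or_of_typeOne U W hU D.hne D.hS D.hF D.hw D.hv D.hrestw D.hrestv D.hpa D.hpb
          (Or.inr ⟨rfl, rfl⟩) (Or.inl ⟨rfl, rfl⟩) hψ hχ hfcf h with h1 | h1
        · exact Finset.disjoint_left.1 (D.hd b D.hb w D.hw D.hbw) (by rw [D.gb]; exact hfb) h1
        · exact Finset.disjoint_left.1 (D.hd b D.hb a D.ha D.hab.symm) (by rw [D.gb]; exact hfb) (by rw [D.ga]; exact h1)
  · exact hfχ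
  · intro hmem
    have hfv : f ∉ esupp (gframe U W v) := fun h =>
      Finset.disjoint_left.1 (D.hd b D.hb v D.hv D.hbv) (by rw [D.gb]; exact hfb) h
    exact typeOne_diff_singleton U W hU D.hne D.hS D.hF D.hv D.hw D.hrestv D.hrestw D.hpa D.hpb
      (Or.inl ⟨rfl, rfl⟩) (Or.inr ⟨rfl, rfl⟩) hχ hψ hfcf hfχ
      ⟨diff_singleton_mem_of_not_affects (isUpperSet_gframe U W hU v) (fun h => hfv (mem_esupp.2 h)) hχ.1.1, hmem⟩

/-- In case B the glued frame of `v` has no vertex. [this work] -/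
theorem verts_gframe_eq_empty {χ₀ ψ₀ : Set ι} (hχ : TypeOne U W v w a b χ₀) (hψ : TypeOne U W w v b a ψ₀) :
    verts (gframe U W v) = ∅ := by
  have hU := D.hU
  refine verts_eq_empty_of_pivotal (isUpperSet_gframe U W hU v) hχ.1.1 (fun f hf => ?_) (fun f hf => ?_)
  all_goals
    have hf' := mem_coe.1 hf
    have hfv : f ∈ esupp (gframe U W v) := (mem_verts.1 hf').1
    have hfcf : CoreFree U f := D.coreFree_of_verts hf'
    have A := typeOne_antipodal U W hU D.hne D.hS D.hF D.hv D.hw D.hrestv D.hrestw D.hpa D.hpb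
      (Or.inl ⟨rfl, rfl⟩) (Or.inr ⟨rfl, rfl⟩) hχ hψ
    have hfχ : f ∈ χ₀ := by
      rcases A.2 f hfcf with h | h
      · exact h
      · exfalso
        rcases mem_esupp_or_of_typeOne U W hU D.hne D.hS D.hF D.hw D.hv D.hrestw D.hrestv D.hpa D.hpb
          (Or.inr ⟨rfl, rfl⟩) (Or.inl ⟨rfl, rfl⟩) hψ hχ hfcf h with h1 | h1
        · exact Finset.disjoint_left.1 (D.hd v D.hv w D.hw D.hvw) hfv h1
        · exact Finset.disjoint_left.1 (D.hd v D.hv a D.ha D.hav.symm) hfv (by rw [D.ga]; exact h1)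
  · exact hfχ
  · intro hmem
    have hfb : f ∉ esupp (U b) := fun h =>
      Finset.disjoint_left.1 (D.hd v D.hv b D.hb D.hbv.symm) hfv (by rw [D.gb]; exact h)
    exact typeOne_diff_singleton U W hU D.hne D.hS D.hF D.hv D.hw D.hrestv D.hrestw D.hpa D.hpb
      (Or.inl ⟨rfl, rfl⟩) (Or.inr ⟨rfl, rfl⟩) hχ hψ hfcf hfχ
      ⟨hmem, diff_singleton_mem_of_not_affects (hU b) (fun h => hfb (mem_esupp.2 h)) hχ.2.2.2⟩

/-- **CASE B**: crossed type-one points are impossible. [this work] -/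
theorem false_of_typeOne_crossed (hNw : (gann U W w).Nonempty) {χ₀ ψ₀ : Set ι} (hχ : TypeOne U W v w a b χ₀)
    (hψ : TypeOne U W w v b a ψ₀) : False := by
  have hU := D.hU
  obtain ⟨f₁, hf₁⟩ := D.hE0
  have A := typeOne_antipodal U W hU D.hne D.hS D.hF D.hv D.hw D.hrestv D.hrestw D.hpa D.hpb
    (Or.inl ⟨rfl, rfl⟩) (Or.inr ⟨rfl, rfl⟩) hχ hψ
  -- the data with `a ↔ b` and `v ↔ w` swapped is again case B, for `ψ₀`
  have D' : LG4Data U W b a w v := (D.swap_vw hNw).swap_ab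
  rcases A.2 f₁ hf₁ with h | h
  · rcases mem_esupp_or_of_typeOne U W hU D.hne D.hS D.hF D.hv D.hw D.hrestv D.hrestw D.hpa D.hpb
      (Or.inl ⟨rfl, rfl⟩) (Or.inr ⟨rfl, rfl⟩) hχ hψ hf₁ h with h1 | h1
    · have := mem_verts_gframe_of_coreFree U W hU hf₁ h1
      rw [D.verts_gframe_eq_empty hχ hψ] at this; exact notMem_empty _ this
    · have := D.mem_verts_of_coreFree_pure D.gb hf₁ h1
      rw [D.verts_host_eq_empty hχ hψ] at this; exact notMem_empty _ this
  · rcases mem_esupp_or_of_typeOne U W hU D.hne D.hS D.hF D.hw D.hv D.hrestw D.hrestv D.hpa D.hpb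
      (Or.inr ⟨rfl, rfl⟩) (Or.inl ⟨rfl, rfl⟩) hψ hχ hf₁ h with h1 | h1
    · have := mem_verts_gframe_of_coreFree U W hU hf₁ h1
      rw [D'.verts_gframe_eq_empty hψ hχ] at this; exact notMem_empty _ this
    · have := D'.mem_verts_of_coreFree_pure D'.gb hf₁ h1
      rw [D'.verts_host_eq_empty hψ hχ] at this; exact notMem_empty _ this

/-- **Two pure + two non-pure with both relevant deletions non-structured is impossible.** [this work] -/
theorem false_of_not_structured (hNw : (gann U W w).Nonempty) (hnsv : ¬ Structured U (insert v ({a, b} : Finset κ)))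
    (hnsw : ¬ Structured U (insert w ({a, b} : Finset κ))) : False := by
  obtain ⟨χ₀, hχ⟩ := exists_typeOne_of_not_structured U W D.hU D.hne D.hS D.hd D.hF D.hE0 D.ha D.hb D.hv D.hab D.hav D.hbv
    D.hrestv D.hpa D.hpb hnsv
  obtain ⟨ψ₀, hψ⟩ := exists_typeOne_of_not_structured U W D.hU D.hne D.hS D.hd D.hF D.hE0 D.ha D.hb D.hw D.hab D.haw D.hbw
    D.hrestw D.hpa D.hpb hnsw
  rcases hχ with hχ | hχ <;> rcases hψ with hψ | hψ
  · exact D.false_of_typeOne_parallel hNw hχ hψ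
  · exact D.false_of_typeOne_crossed hNw hχ hψ
  · exact D.swap_ab.false_of_typeOne_crossed hNw hχ hψ
  · exact D.swap_ab.false_of_typeOne_parallel hNw hχ hψ

end LG4Data

end GluedFrames

end Summit.CriticalPhenomena.PercolationContinuityZ3.Theorems
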